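import Mathlib.Analysis.SpecificLimits.Basic
import HarnessLib

/-!
# NE7EtaLogSlack — route #1 of the NE7 crux (node U5), AMENDMENT 6 supplier bookkeeping (ROAD-G107 §4 «THE SLACK»): A LOGARITHM IN `k` COSTS ONE POWER OF `θ` —
# `(k+1)·θ^k ≤ (1 − θ)⁻¹` for `0 ≤ θ < 1`, hence a gradient bound with the junction logarithm, `≤ K·(1 + c·k)·θ^{(a+1)k}`, is a RATE bound `≤ K·max(1,c)·(1−θ)⁻¹·θ^{ak}`

Cell `pub-balaban`, rung (B)+1 sub-cell t4, lineage `b2b-balaban-t4-ne7-p1`, generation 107 (CRUX PROVER NE7 #1 = OWNER of BINDER row NE7).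
Memo `t4/b2b-balaban-t4-ne7-p1-g107/ROAD-G107.md` §4.
WHY.  The block-Landau slice representative of the relative coordinate carries a codimension-2 junction logarithm `log M = (k+1) log L` in its covariant gradient (NE7b
FINDING-1; ROAD-G107 §2), while the weak socket `h_w` asks the RATE `θ^{38k}` and the energy route gives `θ^{42k}` (`NE7EtaRatesD4Cov.norm_curl_le_rate_cov` with (S-b)'s
Lipschitz letter); this file is the one-line exchange of the logarithm against one of the spare powers of `θ`.
WHAT ([folklore]; 0 def, 0 sorry).  `succ_mul_pow_le_geom_sum` (`(k+1)θ^k ≤ Σ_{j≤k} θ^j`), `geom_sum_le_inv_one_sub`, **`succ_mul_pow_le`** (`(k+1)θ^k ≤ (1−θ)⁻¹`),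
**`log_rate_le_rate`** (`0 ≤ θ < 1`, `0 ≤ K`, any `c`: `K(1 + c k)θ^{(a+1)k} ≤ K·max 1 c·(1−θ)⁻¹·θ^{ak}`).
HONEST FRAMING (page 1): elementary real analysis; nothing of Bałaban's asserted; nothing of NE3∕NE7 discharged; spine count = dagwriter∕referees' call; FIXED FINITE T⁴,
rung (B)+1 — NOT infinite volume, NOT mass gap, NOT BetaPertH, NOT Clay.
-/

set_option autoImplicit false

open scoped BigOperators
open Finset

namespace Summit.QuantumFields.BalabanUV.T4Continuum.NE7EtaLogSlack

/-- `(k+1)·θ^k ≤ Σ_{j<k+1} θ^j` for `0 ≤ θ ≤ 1` (each `θ^k ≤ θ^j`, `j ≤ k`). [folklore] -/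
theorem succ_mul_pow_le_geom_sum {θ : ℝ} (h0 : 0 ≤ θ) (h1 : θ ≤ 1) (k : ℕ) :
    ((k : ℝ) + 1) * θ ^ k ≤ ∑ j ∈ range (k + 1), θ ^ j := by
  have h : ∀ j ∈ range (k + 1), θ ^ k ≤ θ ^ j := fun j hj =>
    pow_le_pow_of_le_one h0 h1 (Nat.lt_succ_iff.mp (mem_range.mp hj))
  calc ((k : ℝ) + 1) * θ ^ k = ∑ _j ∈ range (k + 1), θ ^ k := by
        rw [sum_const, card_range, nsmul_eq_mul]; push_cast; ring
    _ ≤ ∑ j ∈ range (k + 1), θ ^ j := sum_le_sum h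

/-- Partial geometric sums stay below `(1 − θ)⁻¹` for `0 ≤ θ < 1`. [folklore] -/
theorem geom_sum_le_inv_one_sub {θ : ℝ} (h0 : 0 ≤ θ) (h1 : θ < 1) (m : ℕ) : ∑ j ∈ range m, θ ^ j ≤ (1 - θ)⁻¹ := by
  have hpos : 0 < 1 - θ := by linarith
  have hsum : (∑ j ∈ range m, θ ^ j) * (1 - θ) = 1 - θ ^ m := by
    have := geom_sum_mul_neg θ m
    linarith [this]
  have hm : 0 ≤ θ ^ m := pow_nonneg h0 m
  rw [inv_eq_one_div, le_div_iff₀ hpos]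
  nlinarith [hsum, hm]

/-- **`(k+1)·θ^k ≤ (1 − θ)⁻¹`** for `0 ≤ θ < 1` (geometric sum). [folklore] -/
theorem succ_mul_pow_le {θ : ℝ} (h0 : 0 ≤ θ) (h1 : θ < 1) (k : ℕ) : ((k : ℝ) + 1) * θ ^ k ≤ (1 - θ)⁻¹ :=
  (succ_mul_pow_le_geom_sum h0 h1.le k).trans (geom_sum_le_inv_one_sub h0 h1 _)

/-- **A LOGARITHM IN `k` COSTS ONE POWER OF `θ`**: for `0 ≤ θ < 1`, `0 ≤ K`, any real `c` and every `a k : ℕ`,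
`K·(1 + c·k)·θ^{(a+1)k} ≤ K·max 1 c·(1−θ)⁻¹·θ^{ak}`. [folklore] -/
theorem log_rate_le_rate {θ K c : ℝ} (h0 : 0 ≤ θ) (h1 : θ < 1) (hK : 0 ≤ K) (a k : ℕ) :
    K * (1 + c * k) * θ ^ ((a + 1) * k) ≤ K * max 1 c * (1 - θ)⁻¹ * θ ^ (a * k) := by
  have hm1 : (1 : ℝ) ≤ max 1 c := le_max_left _ _
  have hmc : c ≤ max 1 c := le_max_right _ _
  have hm0 : 0 ≤ max 1 c := zero_le_one.trans hm1
  have hk0 : (0 : ℝ) ≤ k := Nat.cast_nonneg k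
  have h1c : 1 + c * k ≤ max 1 c * ((k : ℝ) + 1) := by nlinarith [mul_le_mul_of_nonneg_right hmc hk0]
  have hs := succ_mul_pow_le h0 h1 k
  have hθa : 0 ≤ θ ^ (a * k) := pow_nonneg h0 _
  have e : θ ^ ((a + 1) * k) = θ ^ (a * k) * θ ^ k := by rw [← pow_add]; congr 1; ring
  rw [e]
  calc K * (1 + c * k) * (θ ^ (a * k) * θ ^ k) = K * θ ^ (a * k) * ((1 + c * k) * θ ^ k) := by ring
    _ ≤ K * θ ^ (a * k) * (max 1 c * (((k : ℝ) + 1) * θ ^ k)) := by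
        refine mul_le_mul_of_nonneg_left ?_ (mul_nonneg hK hθa)
        calc (1 + c * k) * θ ^ k ≤ max 1 c * ((k : ℝ) + 1) * θ ^ k := mul_le_mul_of_nonneg_right h1c (pow_nonneg h0 k)
          _ = max 1 c * (((k : ℝ) + 1) * θ ^ k) := by ring
    _ ≤ K * θ ^ (a * k) * (max 1 c * (1 - θ)⁻¹) :=
        mul_le_mul_of_nonneg_left (mul_le_mul_of_nonneg_left hs hm0) (mul_nonneg hK hθa)
    _ = K * max 1 c * (1 - θ)⁻¹ * θ ^ (a * k) := by ring

end Summit.QuantumFields.BalabanUV.T4Continuum.NE7EtaLogSlack
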